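import Summits.QuantumFields.YangMills.Theorems.MarkovAtomsOnsetFloorMarkovTailPrelims
import Summits.QuantumFields.YangMills.Theses.MarkovAtoms
import Summits.QuantumFields.YangMills.Theorems.MarkovAtomsMarkovHolder
import Summits.QuantumFields.YangMills.Theorems.BalabanLadderNTBoundaryLawCore
import Summits.QuantumFields.YangMills.Theorems.BalabanLadderInfVolTranslations
import Summits.QuantumFields.YangMills.Theorems.OnsetSkewLawOnsetVanishing
import Summits.QuantumFields.YangMills.Theorems.LangevinControlUVOSLegsFromFemtoAndGapStubLowerMoments
import HarnessLib

/-!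
# `stub_markovTail` of LINE «MarkovFloorInheritance» — PROVED
# (crux `MarkovAtoms.OnsetFloor`, stmt-QuantumFields-22956; registered stub `stub_markovTail : StubMarkovTailP`)

The tail of the line «MarkovFloorInheritance» on the crux `MarkovAtoms.OnsetFloor`: for an ADMISSIBLE COLLAR BUMP `(b, R₀, t)`
(`AdmBump`: compact support in `[0,R₀]⁴ ∩ {u₀ > 0}`, `∫ b ≠ 0`, permutation symmetric, time-symmetric about `t/2`), a collar
parameter `0 < Λ₀ ≤ 1/2`, ANY `β`, any odd-torus limit state `μ`, and a COARSE POSITIVE-TIME COLLAR ATOM `(q, s ≤ 1, y)` (`q.1 < q.2`,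
`0 ≤ y₀`, collar inequality `R₀ + 1 + 9s ≤ 2y₀ + t`), there is an offset `y'` IN THE CELL `[0,s]⁴` with `|rpSq {q} s y| ≤ V q s y'`
— the RP square of `OnsetSkewLaw.RPOnsetFloor` is dominated by the conditional-mean variance functional `V` of `MarkovAtoms.OnsetFloor`.

Proof = MarkovHolder (`MarkovAtoms.MarkovHolder`, stmt-QuantumFields-22740, landed `markovHolder_proof`) with `n = 2` applied to the
atom and its time mirror, plus bookkeeping, all in this module:
1. `mirrorOffset`, `mirror_weight` — reflected weight = weight at the mirror offset `y_m = (−(t+y₀), y⃗)`.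
2. `cubes_separated_of_collar` — the collar inequality gives MarkovHolder's separation clause (axis 0) for the two crux-cubes.
3. `condVar` (= the crux's `V`, `condVar_eq` by `rfl`), `condVar_translate` — `ℤ⁴`-covariance of `V` in odd-torus limit states
   (tree `kerE_configShift`, `plane_configShift`, `isZdTranslationInvariant_of_mem_oddTorusLimitPoints`, `integral_comp_configShift`).
4. `atomSites`, `bumpAtom_eq_sum`, `continuous_bumpAtom`, `abs_bumpAtom_le`, `isCylinder_bumpAtom` — the atom is a finite sum, hence
   a bounded continuous cylinder observable on its crux-cube (MarkovHolder's hypotheses).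
5. `rpSq_eq_integral_centred` — `rpSq {q} s y = ∫ (F_{y_m} − E F_{y_m})(F_y − E F_y) dμ` (finite double sum × `stateMomentStr_two`).
6. `markovHolder_two` — the `n = 2` instance of `markovHolder_proof`.
7. `markovTail_core`, `stub_markovTail` — `rpSq² ≤ V(y_m)·V(y) ≤ max² ⇒ |rpSq| ≤ V(y*)`, then the cell representative
   `y' = y* − s⌊y*/s⌋` with `V(y') = V(y*)`.

Planner ym-idea-11 g13 (for a free hand to land `--supports stmt-QuantumFields-22956`).  HONEST LABEL: this closes ONE registered
M-stub of one line on one crux; no crux / rung / summit is proved; the Yang–Mills mass gap is NOT proved.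
-/

set_option autoImplicit false

noncomputable section

open MeasureTheory
open scoped BigOperators
open Literature.MathematicalPhysics.QuantumFieldTheory hiding ZdEdge
open Literature.MathematicalPhysics.QuantumLattice hiding cubeEdges cubeSites
open Literature.Probability.LatticeModels (Site)
open Summit.QuantumFields.YangMills.Theorems.InfiniteVolume Summit.QuantumFields.YangMills.Theorems.InfVolRP
open Summit.QuantumFields.YangMills.Cruxes.OSLegsFromFemtoAndGap.DlrCollarTransfer
open Summit.QuantumFields.YangMills.Cruxes.NT.BoundaryLaw (kerE_configShift plane_configShift configShift_configShift)
open Summit.QuantumFields.YangMills.Theorems.OnsetSkewLawGlue (abs_plane_le_N)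
open Summit.QuantumFields.YangMills.Theorems.OSLegsFromFemtoAndGap.StubLower (integrable_of_continuous_compact)
open Summit.QuantumFields.YangMills.Theorems.OnsetTautologyOnsetContraction (stateMomentStr_two)


/-! Landing note (prover ym-line-sfw-p2-w2 g26, 2026-08-29): second half of the planner's module
`pub/ideators/ym-idea-11/g13/MarkovAtomsOnsetFloorMarkovTail.lean` (planner ym-idea-11 g13) — §§ RPSquare /
MarkovHolderTwo / Tail (items 5–7 above and the registered stub `stub_markovTail : StubMarkovTailP`); items 1–4 are
in `MarkovAtomsOnsetFloorMarkovTailPrelims.lean`. Names and namespace unchanged. -/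

namespace Summit.QuantumFields.YangMills.Theorems.MarkovAtomsOnsetFloorMarkovTail


section RPSquare

variable (G : Type) [Group G] [TopologicalSpace G] [IsTopologicalGroup G] [CompactSpace G]
  [MeasurableSpace G] [BorelSpace G] (r : LatticeRep G)

/-- **The RP square is the covariance of the mirror atom and the atom.**  For a profile `b` supported in `[0,R₀]⁴` and
time-symmetric about height `t/2`, a spacing `s > 0`, a valid orientation `q.1 < q.2`, an offset `y` and a probability measure `μ`:
the `rpSq {q} s y` of `OnsetSkewLaw.RPOnsetFloor` (its `let`s expanded, as in `OnsetSkewLawGlue.onsetVanishes`) equals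
`∫ (F_{y_m} − E_μ F_{y_m}) · (F_y − E_μ F_y) dμ` with `F_z = Σ'_x b(s(x + o_q) − z)·plane_q(x)` and `y_m = mirrorOffset t y`. [folklore] -/
theorem rpSq_eq_integral_centred (μ : Measure (LGConfig 4 G)) [IsProbabilityMeasure μ]
    (b : EuclideanSpace ℝ (Fin 4) → ℝ) {R₀ : ℝ} (t : ℝ)
    (hbR : tsupport b ⊆ {u | ∀ j, 0 ≤ u j ∧ u j ≤ R₀})
    (hsym : ∀ u : EuclideanSpace ℝ (Fin 4), b (WithLp.toLp 2 fun i => if i = 0 then t - u i else u i) = b u)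
    {s : ℝ} (hs : 0 < s) {q : Fin 4 × Fin 4} (hq : q.1 < q.2) (y : EuclideanSpace ℝ (Fin 4)) :
    (∑' pp : ((Fin 4 × Fin 4) × (Fin 4 → ℤ)) × ((Fin 4 × Fin 4) × (Fin 4 → ℤ)),
        (if pp.1.1 ∈ ({q} : Finset (Fin 4 × Fin 4)) ∧ pp.1.1.1 < pp.1.1.2 then
            b (timeReflection 4 (s • (siteToE pp.1.2 + centreOffset pp.1.1)) - y) else 0) *
          (if pp.2.1 ∈ ({q} : Finset (Fin 4 × Fin 4)) ∧ pp.2.1.1 < pp.2.1.2 then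
            b (s • (siteToE pp.2.2 + centreOffset pp.2.1) - y) else 0) *
          stateMomentStr G r μ 2 ![pp.1.1, pp.2.1] ![pp.1.2, pp.2.2]) =
      ∫ U, ((∑' x : Fin 4 → ℤ, b (s • (siteToE x + centreOffset q) - mirrorOffset t y) * plane G r q x U) -
              ∫ V, (∑' x : Fin 4 → ℤ, b (s • (siteToE x + centreOffset q) - mirrorOffset t y) * plane G r q x V) ∂μ) *
            ((∑' x : Fin 4 → ℤ, b (s • (siteToE x + centreOffset q) - y) * plane G r q x U) -
              ∫ V, (∑' x : Fin 4 → ℤ, b (s • (siteToE x + centreOffset q) - y) * plane G r q x V) ∂μ) ∂μ := by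
  classical
  haveI : SecondCountableTopology G := r.secondCountableTopology
  -- notation
  have hwr : ∀ x : Fin 4 → ℤ, b (timeReflection 4 (s • (siteToE x + centreOffset q)) - y) =
      b (s • (siteToE x + centreOffset q) - mirrorOffset t y) := fun x => mirror_weight b t hsym _ _
  have hI : ∀ x : Fin 4 → ℤ, Integrable (plane G r q x) μ := fun x =>
    integrable_of_continuous_compact (continuous_plane r q x)
  -- Step A: the pair sum is a finite double sum over `atomSites` of the two offsets
  have hA : (∑' pp : ((Fin 4 × Fin 4) × (Fin 4 → ℤ)) × ((Fin 4 × Fin 4) × (Fin 4 → ℤ)),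
        (if pp.1.1 ∈ ({q} : Finset (Fin 4 × Fin 4)) ∧ pp.1.1.1 < pp.1.1.2 then
            b (timeReflection 4 (s • (siteToE pp.1.2 + centreOffset pp.1.1)) - y) else 0) *
          (if pp.2.1 ∈ ({q} : Finset (Fin 4 × Fin 4)) ∧ pp.2.1.1 < pp.2.1.2 then
            b (s • (siteToE pp.2.2 + centreOffset pp.2.1) - y) else 0) *
          stateMomentStr G r μ 2 ![pp.1.1, pp.2.1] ![pp.1.2, pp.2.2]) =
      ∑ x ∈ atomSites R₀ s (mirrorOffset t y), ∑ x' ∈ atomSites R₀ s y,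
        b (s • (siteToE x + centreOffset q) - mirrorOffset t y) * b (s • (siteToE x' + centreOffset q) - y) *
          ∫ U, (plane G r q x U - ∫ V, plane G r q x V ∂μ) * (plane G r q x' U - ∫ V, plane G r q x' V ∂μ) ∂μ := by
    rw [tsum_eq_sum (s := (({q} : Finset (Fin 4 × Fin 4)) ×ˢ atomSites R₀ s (mirrorOffset t y)) ×ˢ
        (({q} : Finset (Fin 4 × Fin 4)) ×ˢ atomSites R₀ s y))]
    · rw [Finset.sum_product, Finset.sum_product, Finset.sum_singleton]
      refine Finset.sum_congr rfl fun x _ => ?_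
      rw [Finset.sum_product, Finset.sum_singleton]
      refine Finset.sum_congr rfl fun x' _ => ?_
      simp only [Finset.mem_singleton, hq, and_self, if_true, hwr, stateMomentStr_two]
    · intro pp hpp
      rw [Finset.mem_product, not_and_or] at hpp
      rcases hpp with h1 | h2
      · have hz : (if pp.1.1 ∈ ({q} : Finset (Fin 4 × Fin 4)) ∧ pp.1.1.1 < pp.1.1.2 then
            b (timeReflection 4 (s • (siteToE pp.1.2 + centreOffset pp.1.1)) - y) else 0) = 0 := by
          split_ifs with hc
          · have hq1 : pp.1.1 = q := Finset.mem_singleton.1 hc.1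
            have hx : pp.1.2 ∉ atomSites R₀ s (mirrorOffset t y) := fun hx => h1 (Finset.mem_product.2 ⟨hc.1, hx⟩)
            rw [hq1, hwr]
            exact weight_eq_zero_of_not_mem b hbR hs q (mirrorOffset t y) hx
          · rfl
        rw [hz, zero_mul, zero_mul]
      · have hz : (if pp.2.1 ∈ ({q} : Finset (Fin 4 × Fin 4)) ∧ pp.2.1.1 < pp.2.1.2 then
            b (s • (siteToE pp.2.2 + centreOffset pp.2.1) - y) else 0) = 0 := by
          split_ifs with hc
          · have hq1 : pp.2.1 = q := Finset.mem_singleton.1 hc.1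
            have hx : pp.2.2 ∉ atomSites R₀ s y := fun hx => h2 (Finset.mem_product.2 ⟨hc.1, hx⟩)
            rw [hq1]
            exact weight_eq_zero_of_not_mem b hbR hs q y hx
          · rfl
        rw [hz, mul_zero, zero_mul]
  -- Step B: the right-hand side is the same finite double sum
  have hF₁ : ∀ U : LGConfig 4 G, (∑' x : Fin 4 → ℤ, b (s • (siteToE x + centreOffset q) - mirrorOffset t y) * plane G r q x U) =
      ∑ x ∈ atomSites R₀ s (mirrorOffset t y), b (s • (siteToE x + centreOffset q) - mirrorOffset t y) * plane G r q x U :=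
    fun U => congrFun (bumpAtom_eq_sum G r b hbR hs q (mirrorOffset t y)) U
  have hF₂ : ∀ U : LGConfig 4 G, (∑' x : Fin 4 → ℤ, b (s • (siteToE x + centreOffset q) - y) * plane G r q x U) =
      ∑ x ∈ atomSites R₀ s y, b (s • (siteToE x + centreOffset q) - y) * plane G r q x U :=
    fun U => congrFun (bumpAtom_eq_sum G r b hbR hs q y) U
  have hmean : ∀ (S : Finset (Fin 4 → ℤ)) (w : (Fin 4 → ℤ) → ℝ),
      (∫ V, ∑ x ∈ S, w x * plane G r q x V ∂μ) = ∑ x ∈ S, w x * ∫ V, plane G r q x V ∂μ := by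
    intro S w
    rw [integral_finsetSum _ fun x _ => (hI x).const_mul (w x)]
    refine Finset.sum_congr rfl fun x _ => ?_
    exact integral_const_mul (w x) _
  have hcen : ∀ (S : Finset (Fin 4 → ℤ)) (w : (Fin 4 → ℤ) → ℝ) (U : LGConfig 4 G),
      (∑ x ∈ S, w x * plane G r q x U) - ∑ x ∈ S, w x * ∫ V, plane G r q x V ∂μ =
        ∑ x ∈ S, w x * (plane G r q x U - ∫ V, plane G r q x V ∂μ) := by
    intro S w U
    rw [← Finset.sum_sub_distrib]
    simp only [mul_sub]
  rw [hA]
  simp only [hF₁, hF₂]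
  rw [hmean (atomSites R₀ s (mirrorOffset t y)) (fun x => b (s • (siteToE x + centreOffset q) - mirrorOffset t y)),
    hmean (atomSites R₀ s y) (fun x => b (s • (siteToE x + centreOffset q) - y))]
  simp only [hcen, Finset.sum_mul_sum]
  rw [integral_finsetSum _ fun x _ => ?_]
  · refine Finset.sum_congr rfl fun x _ => ?_
    rw [integral_finsetSum _ fun x' _ => ?_]
    · refine Finset.sum_congr rfl fun x' _ => ?_
      rw [← integral_const_mul]
      refine integral_congr_ae (Filter.Eventually.of_forall fun U => ?_)
      simp only
      ring
    · exact integrable_of_continuous_compact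
        ((continuous_const.mul ((continuous_plane r q x).sub continuous_const)).mul
          (continuous_const.mul ((continuous_plane r q x').sub continuous_const)))
  · exact integrable_of_continuous_compact (continuous_finsetSum _ fun x' _ =>
      (continuous_const.mul ((continuous_plane r q x).sub continuous_const)).mul
        (continuous_const.mul ((continuous_plane r q x').sub continuous_const)))

end RPSquare

section Tail

open Finset in
/-- **Markov–Hölder for two cubes, squared form.** `Cov_μ(A₁,A₂)² ≤ V(A₁)·V(A₂)` for a DLR state `μ`, bounded continuous
cylinder observables in two cubes a full lattice layer apart; `V` = the crux's boundary-oscillation variance. [folklore] -/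
theorem markovHolder_two (G : Type) [Group G] [TopologicalSpace G] [IsTopologicalGroup G] [CompactSpace G]
    (hG : IsCompactSimpleLieGroup G) (hiso : Nonempty (G ≃ₜ* Matrix.specialUnitaryGroup (Fin 2) ℂ)) :
    letI : MeasurableSpace G := borel G
    haveI : BorelSpace G := ⟨rfl⟩
    ∀ (r : LatticeRep G) (β : ℝ), ∀ μ ∈ ymGibbsMeasures (d := 4) r.ρ β,
      ∀ (c₁ c₂ : Fin 4 → ℤ) (N₁ N₂ : ℕ) (A₁ A₂ : LGConfig 4 G → ℝ) (K : ℝ),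
        Continuous A₁ → Continuous A₂ → (∀ U, |A₁ U| ≤ K) → (∀ U, |A₂ U| ≤ K) →
        IsCylinder A₁ (cubeEdges c₁ N₁) → IsCylinder A₂ (cubeEdges c₂ N₂) →
        (∃ k : Fin 4, c₁ k + N₁ + 1 ≤ c₂ k ∨ c₂ k + N₂ + 1 ≤ c₁ k) →
        (∫ U, (A₁ U - ∫ V, A₁ V ∂μ) * (A₂ U - ∫ V, A₂ V ∂μ) ∂μ) ^ 2 ≤
          (∫ η, (kerE G r β c₁ N₁ η A₁ - ∫ V, A₁ V ∂μ) ^ 2 ∂μ) *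
            (∫ η, (kerE G r β c₂ N₂ η A₂ - ∫ V, A₂ V ∂μ) ^ 2 ∂μ) := by
  intro r β μ hμ c₁ c₂ N₁ N₂ A₁ A₂ K hc₁ hc₂ hb₁ hb₂ hcy₁ hcy₂ hsep
  letI : MeasurableSpace G := borel G
  haveI : BorelSpace G := ⟨rfl⟩
  have h := Summit.QuantumFields.YangMills.Theorems.MarkovAtoms.markovHolder_proof G hG hiso r β μ hμ 2
    ![c₁, c₂] ![N₁, N₂] ![A₁, A₂] K (by norm_num)
    (by intro i; fin_cases i <;> simp [hc₁, hc₂])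
    (by intro i U; fin_cases i <;> simp [hb₁ U, hb₂ U])
    (by intro i; fin_cases i <;> simp [hcy₁, hcy₂])
    (by
      intro i j hij
      fin_cases i <;> fin_cases j
      · exact absurd rfl hij
      · simpa using hsep
      · obtain ⟨k, hk⟩ := hsep
        exact ⟨k, by simpa [or_comm] using hk⟩
      · exact absurd rfl hij)
  simp only [Fin.prod_univ_two, Matrix.cons_val_zero, Matrix.cons_val_one, Nat.cast_ofNat, sq_abs] at h
  have h1 : 0 ≤ ∫ η, (kerE G r β c₁ N₁ η A₁ - ∫ V, A₁ V ∂μ) ^ 2 ∂μ := integral_nonneg fun _ => sq_nonneg _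
  have h2 : 0 ≤ ∫ η, (kerE G r β c₂ N₂ η A₂ - ∫ V, A₂ V ∂μ) ^ 2 ∂μ := integral_nonneg fun _ => sq_nonneg _
  rw [← Real.sqrt_eq_rpow, ← Real.sqrt_eq_rpow] at h
  calc (∫ U, (A₁ U - ∫ V, A₁ V ∂μ) * (A₂ U - ∫ V, A₂ V ∂μ) ∂μ) ^ 2
      = |∫ U, (A₁ U - ∫ V, A₁ V ∂μ) * (A₂ U - ∫ V, A₂ V ∂μ) ∂μ| ^ 2 := (sq_abs _).symm
    _ ≤ (Real.sqrt (∫ η, (kerE G r β c₁ N₁ η A₁ - ∫ V, A₁ V ∂μ) ^ 2 ∂μ) *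
          Real.sqrt (∫ η, (kerE G r β c₂ N₂ η A₂ - ∫ V, A₂ V ∂μ) ^ 2 ∂μ)) ^ 2 :=
        pow_le_pow_left₀ (abs_nonneg _) h 2
    _ = _ := by rw [mul_pow, Real.sq_sqrt h1, Real.sq_sqrt h2]



/-! ## The tail stub of LINE «MarkovFloorInheritance» — assembled -/

/-- ADMISSIBLE COLLAR BUMP (verbatim from the skeleton `Cruxes/OnsetFloor/Lines/markov-floor-inheritance.lean`; registered-stub
vocabulary, not a citable fact). -/
abbrev AdmBump (b : SchwartzMap (EuclideanSpace ℝ (Fin 4)) ℝ) (R₀ t : ℝ) : Prop :=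
  HasCompactSupport b ∧ tsupport b ⊆ {u : EuclideanSpace ℝ (Fin 4) | ∀ j, 0 ≤ u j ∧ u j ≤ R₀} ∧
  tsupport b ⊆ {u : EuclideanSpace ℝ (Fin 4) | 0 < u 0} ∧ (∫ u, b u) ≠ 0 ∧
  (∀ (π : Equiv.Perm (Fin 4)) (u : EuclideanSpace ℝ (Fin 4)), b (WithLp.toLp 2 fun i => u (π i)) = b u) ∧
  (∀ u : EuclideanSpace ℝ (Fin 4), b (WithLp.toLp 2 fun i => if i = 0 then t - u i else u i) = b u)

/-- The registered stub statement `StubMarkovTailP` of LINE «MarkovFloorInheritance» (verbatim from the skeleton; registered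
stub `stub_markovTail` of stmt-QuantumFields-22956; registered-stub copy, not a citable fact). -/
abbrev StubMarkovTailP : Prop :=
  ∀ (G : Type) [Group G] [TopologicalSpace G] [IsTopologicalGroup G] [CompactSpace G],
    IsCompactSimpleLieGroup G → Nonempty (G ≃ₜ* Matrix.specialUnitaryGroup (Fin 2) ℂ) →
    letI : MeasurableSpace G := borel G
    haveI : BorelSpace G := ⟨rfl⟩
    ∀ (r : LatticeRep G) (b : SchwartzMap (EuclideanSpace ℝ (Fin 4)) ℝ) (R₀ t Λ₀ : ℝ), AdmBump b R₀ t → 0 < Λ₀ → Λ₀ ≤ 1 / 2 →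
      ∀ (β : ℝ), ∀ μ ∈ oddTorusLimitPoints r β,
        let wt : Finset (Fin 4 × Fin 4) → ℝ → EuclideanSpace ℝ (Fin 4) → (Fin 4 × Fin 4) × (Fin 4 → ℤ) → ℝ := fun Q s y p => if p.1 ∈ Q ∧ p.1.1 < p.1.2 then b (s • (siteToE p.2 + centreOffset p.1) - y) else 0 ; let wr : Finset (Fin 4 × Fin 4) → ℝ → EuclideanSpace ℝ (Fin 4) → (Fin 4 × Fin 4) × (Fin 4 → ℤ) → ℝ := fun Q s y p => if p.1 ∈ Q ∧ p.1.1 < p.1.2 then b (timeReflection 4 (s • (siteToE p.2 + centreOffset p.1)) - y) else 0 ; let rpSq : Finset (Fin 4 × Fin 4) → ℝ → EuclideanSpace ℝ (Fin 4) → ℝ := fun Q s y => ∑' pp : ((Fin 4 × Fin 4) × (Fin 4 → ℤ)) × ((Fin 4 × Fin 4) × (Fin 4 → ℤ)), wr Q s y pp.1 * wt Q s y pp.2 * stateMomentStr G r μ 2 ![pp.1.1, pp.2.1] ![pp.1.2, pp.2.2] ; let V : Fin 4 × Fin 4 → ℝ → EuclideanSpace ℝ (Fin 4) → ℝ := fun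 q s y => ∫ η, (kerE G r β (fun j => ⌊y j / s⌋ - (⌈Λ₀ / s⌉₊ : ℕ) - 1) (⌈R₀ / s⌉₊ + 2 * ⌈Λ₀ / s⌉₊ + 4) η (fun U => ∑' x : Fin 4 → ℤ, b (s • (siteToE x + centreOffset q) - y) * plane G r q x U) - ∫ U, (∑' x : Fin 4 → ℤ, b (s • (siteToE x + centreOffset q) - y) * plane G r q x U) ∂μ) ^ 2 ∂μ ; ∀ s : ℝ, 0 < s → s ≤ 1 → ∀ (q : Fin 4 × Fin 4) (y : EuclideanSpace ℝ (Fin 4)), q.1 < q.2 → 0 ≤ y 0 →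
          R₀ + 1 + 9 * s ≤ 2 * y 0 + t →
          ∃ y' : EuclideanSpace ℝ (Fin 4), (∀ i, 0 ≤ y' i ∧ y' i ≤ s) ∧ |rpSq {q} s y| ≤ V q s y'

/-- From `a² ≤ m²` and `0 ≤ m`: `|a| ≤ m`. [folklore] -/
private theorem abs_le_of_sq_le_sq_aux {a m : ℝ} (h : a ^ 2 ≤ m ^ 2) (hm : 0 ≤ m) : |a| ≤ m := by
  rw [abs_le]
  constructor
  · nlinarith [sq_nonneg (a + m), sq_nonneg (a - m)]
  · nlinarith [sq_nonneg (a + m), sq_nonneg (a - m)]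

/-- **The tail, core form** (all `let`s expanded; `V` = `condVar`): for an admissible collar bump, a coarse collar atom and
an odd-torus limit state, the RP square is bounded by the crux's `V` at some offset IN THE CELL `[0,s]⁴`. [folklore] -/
theorem markovTail_core (G : Type) [Group G] [TopologicalSpace G] [IsTopologicalGroup G] [CompactSpace G]
    (hG : IsCompactSimpleLieGroup G) (hiso : Nonempty (G ≃ₜ* Matrix.specialUnitaryGroup (Fin 2) ℂ)) :
    letI : MeasurableSpace G := borel G
    haveI : BorelSpace G := ⟨rfl⟩
    ∀ (r : LatticeRep G) (b : SchwartzMap (EuclideanSpace ℝ (Fin 4)) ℝ) (R₀ t Λ₀ : ℝ), AdmBump b R₀ t → 0 < Λ₀ → Λ₀ ≤ 1 / 2 →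
      ∀ (β : ℝ), ∀ μ ∈ oddTorusLimitPoints r β, ∀ s : ℝ, 0 < s → s ≤ 1 →
        ∀ (q : Fin 4 × Fin 4) (y : EuclideanSpace ℝ (Fin 4)), q.1 < q.2 → 0 ≤ y 0 → R₀ + 1 + 9 * s ≤ 2 * y 0 + t →
          ∃ y' : EuclideanSpace ℝ (Fin 4), (∀ i, 0 ≤ y' i ∧ y' i ≤ s) ∧
            |(∑' pp : ((Fin 4 × Fin 4) × (Fin 4 → ℤ)) × ((Fin 4 × Fin 4) × (Fin 4 → ℤ)),
            (if pp.1.1 ∈ ({q} : Finset (Fin 4 × Fin 4)) ∧ pp.1.1.1 < pp.1.1.2 then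
                b (timeReflection 4 (s • (siteToE pp.1.2 + centreOffset pp.1.1)) - y) else 0) *
              (if pp.2.1 ∈ ({q} : Finset (Fin 4 × Fin 4)) ∧ pp.2.1.1 < pp.2.1.2 then
                b (s • (siteToE pp.2.2 + centreOffset pp.2.1) - y) else 0) *
              stateMomentStr G r μ 2 ![pp.1.1, pp.2.1] ![pp.1.2, pp.2.2])| ≤ condVar G r β μ b Λ₀ R₀ q s y' := by
  intro r b R₀ t Λ₀ hb hΛ0 hΛ β μ hμ s hs hs1 q y hq hy0 hcol
  letI : MeasurableSpace G := borel G
  haveI : BorelSpace G := ⟨rfl⟩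
  haveI : SecondCountableTopology G := r.secondCountableTopology
  haveI : T2Space G := (r.continuous.isClosedEmbedding r.injective).isEmbedding.t2Space
  have hμinf : μ ∈ infiniteVolumeLimitPoints (d := 4) r.ρ β := by
    obtain ⟨S, hS, h⟩ := hμ
    exact ⟨fun k => 2 * S k, fun i j hij => Nat.mul_lt_mul_of_pos_left (hS hij) two_pos, h⟩
  have hμG : μ ∈ ymGibbsMeasures (d := 4) r.ρ β :=
    mem_ymGibbsMeasures_of_mem_infiniteVolumeLimitPoints_holds (ρ := r.ρ) r.continuous hμinf
  haveI : IsProbabilityMeasure μ := hμG.isProbabilityMeasure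
  obtain ⟨_, hbR, _, hbint, _, hbsym⟩ := hb
  -- `0 ≤ R₀`: the support box is non-empty since `∫ b ≠ 0`
  have hR0 : 0 ≤ R₀ := by
    by_contra hneg
    apply hbint
    have hzero : ∀ u : EuclideanSpace ℝ (Fin 4), b u = 0 := by
      intro u
      by_contra hu
      have hu' := hbR (subset_tsupport _ (Function.mem_support.2 hu))
      have h1 := (hu' 0).1
      have h2 := (hu' 0).2
      exact hneg (h1.trans h2)
    simp [hzero]
  -- the two offsets, their cube corners, the common bound
  set y₁ : EuclideanSpace ℝ (Fin 4) := mirrorOffset t y with hy₁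
  have hsep : ∃ k : Fin 4,
      (fun j => ⌊y₁ j / s⌋ - (⌈Λ₀ / s⌉₊ : ℕ) - 1 : Fin 4 → ℤ) k + (⌈R₀ / s⌉₊ + 2 * ⌈Λ₀ / s⌉₊ + 4 : ℕ) + 1 ≤
          (fun j => ⌊y j / s⌋ - (⌈Λ₀ / s⌉₊ : ℕ) - 1 : Fin 4 → ℤ) k ∨
        (fun j => ⌊y j / s⌋ - (⌈Λ₀ / s⌉₊ : ℕ) - 1 : Fin 4 → ℤ) k + (⌈R₀ / s⌉₊ + 2 * ⌈Λ₀ / s⌉₊ + 4 : ℕ) + 1 ≤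
          (fun j => ⌊y₁ j / s⌋ - (⌈Λ₀ / s⌉₊ : ℕ) - 1 : Fin 4 → ℤ) k := by
    refine ⟨0, Or.inl ?_⟩
    simp only [hy₁, mirrorOffset_apply_zero]
    exact cubes_separated_of_collar hs hΛ0 hΛ hR0 hcol
  set K : ℝ := max ((∑ x ∈ atomSites R₀ s y₁, |b (s • (siteToE x + centreOffset q) - y₁)|) * r.N)
      ((∑ x ∈ atomSites R₀ s y, |b (s • (siteToE x + centreOffset q) - y)|) * r.N) with hK
  have hMH := markovHolder_two G hG hiso r β μ hμG
    (fun j => ⌊y₁ j / s⌋ - (⌈Λ₀ / s⌉₊ : ℕ) - 1) (fun j => ⌊y j / s⌋ - (⌈Λ₀ / s⌉₊ : ℕ) - 1)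
    (⌈R₀ / s⌉₊ + 2 * ⌈Λ₀ / s⌉₊ + 4) (⌈R₀ / s⌉₊ + 2 * ⌈Λ₀ / s⌉₊ + 4)
    (fun U => ∑' x : Fin 4 → ℤ, b (s • (siteToE x + centreOffset q) - y₁) * plane G r q x U)
    (fun U => ∑' x : Fin 4 → ℤ, b (s • (siteToE x + centreOffset q) - y) * plane G r q x U) K
    (continuous_bumpAtom G r b hbR hs q y₁) (continuous_bumpAtom G r b hbR hs q y)
    (fun U => (abs_bumpAtom_le G r b hbR hs q y₁ U).trans (le_max_left _ _))
    (fun U => (abs_bumpAtom_le G r b hbR hs q y U).trans (le_max_right _ _))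
    (isCylinder_bumpAtom G r b hbR hs q y₁ Λ₀) (isCylinder_bumpAtom G r b hbR hs q y Λ₀) hsep
  -- `hMH : (∫ (F₁ − E F₁)(F₂ − E F₂))² ≤ V(y₁) · V(y)`; the RP square IS that integral
  have hMH' : ((∑' pp : ((Fin 4 × Fin 4) × (Fin 4 → ℤ)) × ((Fin 4 × Fin 4) × (Fin 4 → ℤ)),
            (if pp.1.1 ∈ ({q} : Finset (Fin 4 × Fin 4)) ∧ pp.1.1.1 < pp.1.1.2 then
                b (timeReflection 4 (s • (siteToE pp.1.2 + centreOffset pp.1.1)) - y) else 0) *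
              (if pp.2.1 ∈ ({q} : Finset (Fin 4 × Fin 4)) ∧ pp.2.1.1 < pp.2.1.2 then
                b (s • (siteToE pp.2.2 + centreOffset pp.2.1) - y) else 0) *
              stateMomentStr G r μ 2 ![pp.1.1, pp.2.1] ![pp.1.2, pp.2.2])) ^ 2 ≤
      condVar G r β μ b Λ₀ R₀ q s y₁ * condVar G r β μ b Λ₀ R₀ q s y := by
    rw [rpSq_eq_integral_centred G r μ b t hbR hbsym hs hq y]
    exact hMH
  have hV₁ : 0 ≤ condVar G r β μ b Λ₀ R₀ q s y₁ := integral_nonneg fun _ => sq_nonneg _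
  have hV₂ : 0 ≤ condVar G r β μ b Λ₀ R₀ q s y := integral_nonneg fun _ => sq_nonneg _
  -- the better offset `y*` and its cell representative
  obtain ⟨ys, hys⟩ : ∃ ys : EuclideanSpace ℝ (Fin 4),
      |(∑' pp : ((Fin 4 × Fin 4) × (Fin 4 → ℤ)) × ((Fin 4 × Fin 4) × (Fin 4 → ℤ)),
              (if pp.1.1 ∈ ({q} : Finset (Fin 4 × Fin 4)) ∧ pp.1.1.1 < pp.1.1.2 then
                  b (timeReflection 4 (s • (siteToE pp.1.2 + centreOffset pp.1.1)) - y) else 0) *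
                (if pp.2.1 ∈ ({q} : Finset (Fin 4 × Fin 4)) ∧ pp.2.1.1 < pp.2.1.2 then
                  b (s • (siteToE pp.2.2 + centreOffset pp.2.1) - y) else 0) *
                stateMomentStr G r μ 2 ![pp.1.1, pp.2.1] ![pp.1.2, pp.2.2])| ≤ condVar G r β μ b Λ₀ R₀ q s ys := by
    by_cases hle : condVar G r β μ b Λ₀ R₀ q s y ≤ condVar G r β μ b Λ₀ R₀ q s y₁
    · refine ⟨y₁, abs_le_of_sq_le_sq_aux (hMH'.trans ?_) hV₁⟩
      rw [sq]
      exact mul_le_mul_of_nonneg_left hle hV₁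
    · refine ⟨y, abs_le_of_sq_le_sq_aux (hMH'.trans ?_) hV₂⟩
      rw [sq]
      exact mul_le_mul_of_nonneg_right (not_le.1 hle).le hV₂
  -- cell representative `y' = ys − s ⌊ys/s⌋ = ys + s • siteToE (−⌊ys/s⌋)`
  refine ⟨ys + s • siteToE (d := 4) (-(fun j => ⌊ys j / s⌋)), fun i => ?_, ?_⟩
  · have hcoord : (ys + s • siteToE (d := 4) (-(fun j => ⌊ys j / s⌋))) i = ys i - ⌊ys i / s⌋ * s := by
      simp [siteToE_apply]
      ring
    rw [hcoord]
    exact ⟨Int.sub_floor_div_mul_nonneg _ hs, (Int.sub_floor_div_mul_lt _ hs).le⟩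
  · rw [condVar_translate G r hμ b Λ₀ R₀ q hs.ne' ys]
    exact hys

/-- **`stub_markovTail`** — the registered tail stub of LINE «MarkovFloorInheritance» (stmt-QuantumFields-22956), by name and
signature.  [folklore; MarkovHolder (stmt-QuantumFields-22740) + DLR covariance bookkeeping] [folklore] -/
theorem stub_markovTail : StubMarkovTailP := by
  intro G _ _ _ _ hG hiso r b R₀ t Λ₀ hb hΛ0 hΛ β μ hμ
  exact markovTail_core G hG hiso r b R₀ t Λ₀ hb hΛ0 hΛ β μ hμ

end Tail

end Summit.QuantumFields.YangMills.Theorems.MarkovAtomsOnsetFloorMarkovTail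

end
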